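import Mathlib.MeasureTheory.Integral.MeanInequalities
import Literature.Analysis.FluidPDE.SteadyNavierStokesEnergy
import Literature.Analysis.FluidPDE.DoeringFoiasPowerProofs
import Literature.Analysis.FunctionSpaces.TorusFourierSeries
import Literature.Analysis.FunctionSpaces.TorusLerayHelmholtz
import Literature.Analysis.FunctionSpaces.TorusFluidGlueProofs
import Literature.Analysis.FunctionSpaces.TorusFourierCalculus
import Literature.Analysis.FunctionSpaces.TorusTruncationH1
import HarnessLib

/-!
# The linearised steady Navier–Stokes form under Fourier truncation: `L²`/`H¹` bookkeeping

Analysis/FunctionSpaces support file (theorem-only, no definitions, no named facts). For smooth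
fields on `T^d` the linearisation at `v` of the tested steady Navier–Stokes form,
`(w, a) ↦ ∫ ⟪w,(v·∇)a⟫ + ⟪v,(w·∇)a⟫ + ν⟪w,Δa⟫`, is compared term by term with the same expression
after replacing the test `a` by its truncation `P_N a = Torus.fourierTruncate N a`, or the base field
`v` by a uniformly close `v'` — the elementary estimates behind the Galerkin stability of nonsingular
solutions (Brezzi–Rappaz–Raviart 1980, Part I §3; Girault–Raviart 1986, Ch. IV §3):
* for band-limited `w` the viscous term is unchanged, `∫ ⟪w, Δ P_N a⟫ = ∫ ⟪w, Δa⟫`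
  (`integral_inner_laplacian_fourierTruncate_eq_of_band_limited`);
* the convective terms move by at most `C‖∇w‖₂‖P_N a - a‖₂`, `D‖w‖₂‖P_N a - a‖₂` (`C = sup ‖v‖`,
  `D = sup |∇v|`; antisymmetry of the trilinear form for divergence-free `v`, `w`), with the
  spectral gap `4π²(N²+1)‖P_N a - a‖₂² ≤ ‖∇a‖₂²` (`integral_norm_sq_fourierTruncate_sub_le_gradNormSq`,
  `abs_integral_inner_convect_fourierTruncate_sub_le`, `…_le'`);
* replacing `v` by `v'` with `‖v' - v‖_∞ ≤ T` costs at most `T‖w‖₂‖∇a‖₂` per convective term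
  (`abs_integral_inner_convect_sub_le_of_norm_sub_le`, `…_le'`);
* tools: the Frobenius bound `‖Da(x)h‖ ≤ ‖h‖(∑ᵢ‖∂ᵢa(x)‖²)^{1/2}`, Cauchy–Schwarz for pairings,
  Poincaré `4π²‖w‖₂² ≤ ‖∇w‖₂²` for smooth mean-zero `w`, `‖∇P_N a‖₂ ≤ ‖∇a‖₂`, sup bounds of smooth
  fields, and the degenerate case `‖∇a‖₂ = 0` (then `(u·∇)a = 0`, `Δa = 0`).
Dimension-free; built on the tree's torus calculus / Fourier bookkeeping and Mathlib's Hölder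
inequality `MeasureTheory.integral_mul_norm_le_Lp_mul_Lq`.

References: F. Brezzi, J. Rappaz, P.-A. Raviart, Numer. Math. 36 (1980) 1–25, §3
[BrezziRappazRaviart1980]; V. Girault, P.-A. Raviart, *Finite Element Approximation of the Navier–Stokes
Equations* (1979/1986), Ch. IV §3 [GiraultRaviart1979]; R. Temam, *Navier–Stokes Equations* (1984),
Ch. II §1.2 (trilinear form) [Temam1984].
-/


noncomputable section

open MeasureTheory Filter Topology UnitAddTorus
open scoped InnerProductSpace ENNReal

namespace Literature.Analysis.FunctionSpaces

namespace Torus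

variable {d : Type*} [Fintype d] [DecidableEq d]

/-! ## Pointwise and `L²` tools -/

/-- **Frobenius bound**: `‖Da(x) h‖ ≤ ‖h‖ (∑ᵢ ‖∂ᵢa(x)‖²)^{1/2}` for a `C¹` field `a` on `T^d`
(`Da(x) h = ∑ᵢ hᵢ ∂ᵢa(x)` and Cauchy–Schwarz in `i`). [folklore] -/
theorem norm_fderiv_apply_le_mul_sqrt {F : Type*} [NormedAddCommGroup F] [NormedSpace ℝ F]
    {a : UnitAddTorus d → F} (ha : IsContDiff 1 a) (x : UnitAddTorus d)
    (h : EuclideanSpace ℝ d) :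
    ‖Torus.fderiv a x h‖ ≤ ‖h‖ * Real.sqrt (∑ i, ‖partialDeriv i a x‖ ^ 2) := by
  rw [fderiv_apply_eq_sum_partialDeriv ha x h]
  calc ‖∑ j, h j • partialDeriv j a x‖ ≤ ∑ j, ‖h j • partialDeriv j a x‖ := norm_sum_le _ _
    _ = ∑ j, |h j| * ‖partialDeriv j a x‖ := by simp [norm_smul]
    _ ≤ Real.sqrt (∑ j, |h j| ^ 2) * Real.sqrt (∑ j, ‖partialDeriv j a x‖ ^ 2) := by
        rw [← Real.sqrt_mul (Finset.sum_nonneg fun j _ => sq_nonneg _)]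
        exact Real.le_sqrt_of_sq_le (Finset.sum_mul_sq_le_sq_mul_sq _ _ _)
    _ = ‖h‖ * Real.sqrt (∑ j, ‖partialDeriv j a x‖ ^ 2) := by
        rw [EuclideanSpace.norm_eq]
        simp [Real.norm_eq_abs]

/-- The convective derivative: `‖(b·∇)a(x)‖ ≤ ‖b x‖ (∑ᵢ ‖∂ᵢa(x)‖²)^{1/2}` for `C¹` `a`. [folklore] -/
theorem norm_convect_le_norm_mul_sqrt {F : Type*} [NormedAddCommGroup F] [NormedSpace ℝ F]
    {a : UnitAddTorus d → F} (ha : IsContDiff 1 a)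
    (b : UnitAddTorus d → EuclideanSpace ℝ d) (x : UnitAddTorus d) :
    ‖convect b a x‖ ≤ ‖b x‖ * Real.sqrt (∑ i, ‖partialDeriv i a x‖ ^ 2) :=
  norm_fderiv_apply_le_mul_sqrt ha x (b x)

omit [DecidableEq d] in
/-- **Cauchy–Schwarz** for norms of `L²` fields on `T^d`:
`∫ ‖f‖ ‖g‖ ≤ (∫ ‖f‖²)^{1/2} (∫ ‖g‖²)^{1/2}` (Mathlib's Hölder inequality with `p = q = 2`). [folklore] -/
theorem integral_norm_mul_norm_le_sqrt_sq_mul_sqrt_sq {F G : Type*} [NormedAddCommGroup F]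
    [NormedAddCommGroup G] {f : UnitAddTorus d → F} {g : UnitAddTorus d → G}
    (hf : MemLp f 2 volume) (hg : MemLp g 2 volume) :
    ∫ x, ‖f x‖ * ‖g x‖ ≤ Real.sqrt (∫ x, ‖f x‖ ^ 2) * Real.sqrt (∫ x, ‖g x‖ ^ 2) := by
  have h := integral_mul_norm_le_Lp_mul_Lq (μ := volume) (f := fun x => ‖f x‖) (g := fun x => ‖g x‖)
    Real.HolderConjugate.two_two (by simpa using hf.norm) (by simpa using hg.norm)
  simp only [norm_norm, Real.rpow_two, one_div, Real.sqrt_eq_rpow] at h ⊢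
  exact h

omit [DecidableEq d] in
/-- **Cauchy–Schwarz for pairings**: `|∫ ⟪f, g⟫| ≤ (∫ ‖f‖²)^{1/2} (∫ ‖g‖²)^{1/2}` for `L²`
fields with values in a real inner product space — the torus/`volume` instance of the general
`Literature.Analysis.FluidPDE.abs_integral_inner_le_sqrt_mul_sqrt`
(`FluidPDE/CheskidovAssemblyTools.lean`), kept as a deprecated alias (librarian dedup-01554).
[folklore] -/
@[deprecated Literature.Analysis.FluidPDE.abs_integral_inner_le_sqrt_mul_sqrt
  (since := "2026-08-16")]
alias abs_integral_inner_le_sqrt_sq_mul_sqrt_sq :=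
  Literature.Analysis.FluidPDE.abs_integral_inner_le_sqrt_mul_sqrt

omit [DecidableEq d] in
/-- A smooth field on the (compact) torus is bounded: `‖v x‖ ≤ C` for some `C ≥ 0`. [folklore] -/
theorem exists_forall_norm_le_of_isSmooth {F : Type*} [NormedAddCommGroup F] [NormedSpace ℝ F]
    {v : UnitAddTorus d → F} (hv : IsSmooth v) : ∃ C : ℝ, 0 ≤ C ∧ ∀ x, ‖v x‖ ≤ C := by
  obtain ⟨C, hC⟩ := isCompact_univ.exists_bound_of_continuousOn hv.continuous.continuousOn
  exact ⟨max C 0, le_max_right _ _, fun x => (hC x (Set.mem_univ x)).trans (le_max_left _ _)⟩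

/-- The Frobenius norm of the gradient of a smooth field is continuous. [folklore] -/
theorem continuous_sqrt_sum_norm_partialDeriv_sq {F : Type*} [NormedAddCommGroup F] [NormedSpace ℝ F]
    {a : UnitAddTorus d → F} (ha : IsSmooth a) :
    Continuous fun x => Real.sqrt (∑ i, ‖partialDeriv i a x‖ ^ 2) :=
  Real.continuous_sqrt.comp (continuous_finsetSum _ fun i _ => (ha.partialDeriv i).continuous.norm.pow 2)

/-- The Frobenius norm of the gradient of a smooth field is bounded:
`(∑ᵢ ‖∂ᵢv(x)‖²)^{1/2} ≤ D` for some `D ≥ 0`. [folklore] -/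
theorem exists_forall_sqrt_sum_sq_le_of_isSmooth {F : Type*} [NormedAddCommGroup F] [NormedSpace ℝ F]
    {v : UnitAddTorus d → F} (hv : IsSmooth v) :
    ∃ D : ℝ, 0 ≤ D ∧ ∀ x, Real.sqrt (∑ i, ‖partialDeriv i v x‖ ^ 2) ≤ D := by
  obtain ⟨D, hD⟩ := isCompact_univ.exists_bound_of_continuousOn
    (continuous_sqrt_sum_norm_partialDeriv_sq hv).continuousOn
  refine ⟨max D 0, le_max_right _ _, fun x => ?_⟩
  have h := hD x (Set.mem_univ x)
  rw [Real.norm_eq_abs, abs_of_nonneg (Real.sqrt_nonneg _)] at h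
  exact h.trans (le_max_left _ _)

/-- **`L²` bound of `(v·∇)w` by the sup of `v`**: if `‖v x‖ ≤ C` everywhere then
`∫ ‖(v·∇)w‖² ≤ C² ‖∇w‖₂²` for smooth `w`. [folklore] -/
theorem integral_norm_sq_convect_le_of_norm_le {v w : UnitAddTorus d → EuclideanSpace ℝ d}
    (hw : IsSmooth w) {C : ℝ} (hvC : ∀ x, ‖v x‖ ≤ C) :
    ∫ x, ‖convect v w x‖ ^ 2 ≤ C ^ 2 * gradNormSq w := by
  have hw1 : IsContDiff 1 w := hw.isContDiff (by simp)
  have hS : Integrable (fun x => ∑ i, ‖partialDeriv i w x‖ ^ 2) volume :=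
    (continuous_finsetSum _ fun i _ => (hw.partialDeriv i).continuous.norm.pow 2).integrable_unitAddTorus
  rw [gradNormSq, ← integral_const_mul]
  refine integral_mono_of_nonneg (ae_of_all _ fun x => sq_nonneg _) (hS.const_mul _)
    (ae_of_all _ fun x => ?_)
  have h0 : 0 ≤ ∑ i, ‖partialDeriv i w x‖ ^ 2 := Finset.sum_nonneg fun i _ => sq_nonneg _
  calc ‖convect v w x‖ ^ 2 ≤ (‖v x‖ * Real.sqrt (∑ i, ‖partialDeriv i w x‖ ^ 2)) ^ 2 :=
        pow_le_pow_left₀ (norm_nonneg _) (norm_convect_le_norm_mul_sqrt hw1 v x) 2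
    _ = ‖v x‖ ^ 2 * ∑ i, ‖partialDeriv i w x‖ ^ 2 := by rw [mul_pow, Real.sq_sqrt h0]
    _ ≤ C ^ 2 * ∑ i, ‖partialDeriv i w x‖ ^ 2 :=
        mul_le_mul_of_nonneg_right (pow_le_pow_left₀ (norm_nonneg _) (hvC x) 2) h0

omit [DecidableEq d] in
/-- **`L²` bound of `(w·∇)v` by the sup of `∇v`**: if `(∑ᵢ ‖∂ᵢv(x)‖²)^{1/2} ≤ D` everywhere then
`∫ ‖(w·∇)v‖² ≤ D² ∫ ‖w‖²` for `C¹` `v` and continuous `w`. [folklore] -/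
theorem integral_norm_sq_convect_le_of_sqrt_le [DecidableEq d] {v w : UnitAddTorus d → EuclideanSpace ℝ d}
    (hv : IsContDiff 1 v) (hw : Continuous w) {D : ℝ}
    (hvD : ∀ x, Real.sqrt (∑ i, ‖partialDeriv i v x‖ ^ 2) ≤ D) :
    ∫ x, ‖convect w v x‖ ^ 2 ≤ D ^ 2 * ∫ x, ‖w x‖ ^ 2 := by
  rw [← integral_const_mul]
  refine integral_mono_of_nonneg (ae_of_all _ fun x => sq_nonneg _)
    ((hw.norm.pow 2).integrable_unitAddTorus.const_mul _) (ae_of_all _ fun x => ?_)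
  calc ‖convect w v x‖ ^ 2 ≤ (‖w x‖ * Real.sqrt (∑ i, ‖partialDeriv i v x‖ ^ 2)) ^ 2 :=
        pow_le_pow_left₀ (norm_nonneg _) (norm_convect_le_norm_mul_sqrt hv w x) 2
    _ ≤ (‖w x‖ * D) ^ 2 := pow_le_pow_left₀ (by positivity)
        (mul_le_mul_of_nonneg_left (hvD x) (norm_nonneg _)) 2
    _ = D ^ 2 * ‖w x‖ ^ 2 := by ring

/-! ## Poincaré, truncation error and truncated enstrophy for smooth fields -/

/-- **Poincaré inequality for smooth mean-zero fields**: `4π² ∫ ‖w‖² ≤ ‖∇w‖₂²` (`λ₁ = 4π²` on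
`ℝ^d/ℤ^d`; the tree's spectral form `ofReal_integral_norm_sq_le_eGradNormSq_add` read for a smooth
field, whose spectral and classical gradient norms agree). [folklore] -/
theorem four_pi_sq_mul_integral_norm_sq_le_gradNormSq {w : UnitAddTorus d → EuclideanSpace ℝ d}
    (hw : IsSmooth w) (h0 : HasZeroMean w) :
    4 * Real.pi ^ 2 * ∫ x, ‖w x‖ ^ 2 ≤ gradNormSq w := by
  have h1 := FluidPDE.ofReal_integral_norm_sq_le_eGradNormSq_add (hw.memLp 2)
  have h0' : ∫ x, w x = 0 := h0
  rw [h0', norm_zero, zero_pow two_ne_zero, mul_zero, ENNReal.ofReal_zero, add_zero] at h1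
  rw [gradNormSq_eq_toReal_eGradNormSq_holds hw]
  exact (ENNReal.ofReal_le_iff_le_toReal (eGradNormSq_lt_top hw).ne).1 h1

/-- Poincaré, square-root form: `(∫ ‖w‖²)^{1/2} ≤ ‖∇w‖₂ / (2π)` for smooth mean-zero `w`. [folklore] -/
theorem sqrt_integral_norm_sq_le_of_hasZeroMean {w : UnitAddTorus d → EuclideanSpace ℝ d}
    (hw : IsSmooth w) (h0 : HasZeroMean w) :
    Real.sqrt (∫ x, ‖w x‖ ^ 2) ≤ Real.sqrt (gradNormSq w) / (2 * Real.pi) := by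
  have hπ : 0 < 2 * Real.pi := Real.two_pi_pos
  rw [le_div_iff₀ hπ, ← Real.sqrt_sq hπ.le, ← Real.sqrt_mul (integral_nonneg fun x => sq_nonneg _)]
  refine Real.sqrt_le_sqrt ?_
  have h := four_pi_sq_mul_integral_norm_sq_le_gradNormSq hw h0
  nlinarith [h]

/-- **The truncation error in `L²` by the enstrophy**: `∫ ‖P_N a - a‖² ≤ ‖∇a‖₂² / (4π²(N²+1))`
for smooth `a` (the spectral gap of the tail, `lintegral_enorm_sq_fourierTruncate_sub_le`, and
`tail ≤ ‖∇a‖₂²`). [folklore] -/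
theorem integral_norm_sq_fourierTruncate_sub_le_gradNormSq {a : UnitAddTorus d → EuclideanSpace ℝ d}
    (ha : IsSmooth a) (N : ℕ) :
    ∫ x, ‖fourierTruncate N a x - a x‖ ^ 2 ≤ gradNormSq a / (4 * Real.pi ^ 2 * ((N : ℝ) ^ 2 + 1)) := by
  have htop : eGradNormSq a ≠ ⊤ := (eGradNormSq_lt_top ha).ne
  have htail : FluidPDE.Torus.tailGradNormSq N a ≠ ⊤ := ne_top_of_le_ne_top htop (FluidPDE.Torus.tailGradNormSq_le N a)
  refine (FluidPDE.Torus.integral_norm_sq_fourierTruncate_sub_le (ha.memLp 2) N htail).trans ?_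
  rw [gradNormSq_eq_toReal_eGradNormSq_holds ha]
  exact div_le_div_of_nonneg_right (ENNReal.toReal_mono htop (FluidPDE.Torus.tailGradNormSq_le N a)) (by positivity)

/-- Square-root form: `(∫ ‖P_N a - a‖²)^{1/2} ≤ ‖∇a‖₂ / (2π (N²+1)^{1/2})` for smooth `a`. [folklore] -/
theorem sqrt_integral_norm_sq_fourierTruncate_sub_le {a : UnitAddTorus d → EuclideanSpace ℝ d}
    (ha : IsSmooth a) (N : ℕ) :
    Real.sqrt (∫ x, ‖fourierTruncate N a x - a x‖ ^ 2) ≤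
      Real.sqrt (gradNormSq a) / (2 * Real.pi * Real.sqrt ((N : ℝ) ^ 2 + 1)) := by
  have h := Real.sqrt_le_sqrt (integral_norm_sq_fourierTruncate_sub_le_gradNormSq ha N)
  rw [Real.sqrt_div' _ (by positivity), Real.sqrt_mul (by positivity), Real.sqrt_mul (by positivity),
    Real.sqrt_sq Real.pi_pos.le, show Real.sqrt 4 = 2 by
      rw [show (4 : ℝ) = 2 ^ 2 by norm_num, Real.sqrt_sq zero_le_two]] at h
  exact h

/-- **Truncation does not increase the `H¹` seminorm**: `‖∇P_N a‖₂² ≤ ‖∇a‖₂²` — duplicate of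
`Torus.gradNormSq_fourierTruncate_le` (`TorusTruncationH1.lean`), kept as a deprecated alias
(librarian g24, gate dedup.landed on p117541). [folklore] -/
@[deprecated gradNormSq_fourierTruncate_le (since := "2026-08-16")]
alias gradNormSq_fourierTruncate_le_gradNormSq := gradNormSq_fourierTruncate_le

/-! ## The viscous term is blind to the truncation of the test -/

/-- **`∫ ⟪w, Δ P_N a⟫ = ∫ ⟪w, Δa⟫` for band-limited `w`**: if `w ∈ L²` has no Fourier modes outside
the ball `|k|² ≤ N²` and `a` is smooth (`Δ P_N a = P_N Δa`, and `P_N` is invisible to band-limited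
fields, `Torus.integral_inner_fourierTruncate_eq`). [folklore] -/
theorem integral_inner_laplacian_fourierTruncate_eq_of_band_limited
    {w a : UnitAddTorus d → EuclideanSpace ℝ d} (hw : MemLp w 2 volume) (ha : IsSmooth a) {N : ℕ}
    (hband : ∀ k ∉ freqBall N, mFourierCoeff (EuclideanSpace.complexify ∘ w) k = 0) :
    ∫ x, ⟪w x, laplacian (fourierTruncate N a) x⟫_ℝ = ∫ x, ⟪w x, laplacian a x⟫_ℝ := by
  simp_rw [laplacian_fourierTruncate ha N]
  calc ∫ x, ⟪w x, fourierTruncate N (laplacian a) x⟫_ℝ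
      = ∫ x, ⟪fourierTruncate N (laplacian a) x, w x⟫_ℝ :=
        integral_congr_ae (ae_of_all _ fun x => real_inner_comm _ _)
    _ = ∫ x, ⟪laplacian a x, w x⟫_ℝ := integral_inner_fourierTruncate_eq (ha.laplacian.memLp 2) hw hband
    _ = ∫ x, ⟪w x, laplacian a x⟫_ℝ := integral_congr_ae (ae_of_all _ fun x => real_inner_comm _ _)

/-! ## The convective terms under truncation of the test -/

omit [DecidableEq d] in
/-- `(u·∇)(f - g) = (u·∇)f - (u·∇)g` pointwise for `C¹` fields. [folklore] -/
theorem convect_sub {F : Type*} [NormedAddCommGroup F] [NormedSpace ℝ F]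
    (u : UnitAddTorus d → EuclideanSpace ℝ d) {f g : UnitAddTorus d → F}
    (hf : IsContDiff 1 f) (hg : IsContDiff 1 g)
    (x : UnitAddTorus d) : convect u (f - g) x = convect u f x - convect u g x := by
  simp only [convect, fderiv_sub hf hg x, FunLike.coe_sub, Pi.sub_apply]

/-- **First convective term**: for smooth divergence-free `v` with `‖v‖ ≤ C`, smooth `w`, `a`,
`|∫ ⟪w,(v·∇)P_N a⟫ - ∫ ⟪w,(v·∇)a⟫| ≤ C ‖∇w‖₂ · ‖∇a‖₂ / (2π (N²+1)^{1/2})`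
(move the derivative to `w` by antisymmetry, Cauchy–Schwarz, the `L²` truncation error). [folklore] -/
theorem abs_integral_inner_convect_fourierTruncate_sub_le {v w a : UnitAddTorus d → EuclideanSpace ℝ d}
    (hv : IsSmooth v) (hvd : IsDivFree v) (hw : IsSmooth w) (ha : IsSmooth a) {C : ℝ} (hC : 0 ≤ C)
    (hvC : ∀ x, ‖v x‖ ≤ C) (N : ℕ) :
    |(∫ x, ⟪w x, convect v (fourierTruncate N a) x⟫_ℝ) - ∫ x, ⟪w x, convect v a x⟫_ℝ| ≤
      C * Real.sqrt (gradNormSq w) *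
        (Real.sqrt (gradNormSq a) / (2 * Real.pi * Real.sqrt ((N : ℝ) ^ 2 + 1))) := by
  set b : UnitAddTorus d → EuclideanSpace ℝ d := fourierTruncate N a - a with hb
  have hPa : IsSmooth (fourierTruncate N a) := isSmooth_fourierTruncate N a
  have hbs : IsSmooth b := hPa.sub ha
  -- the difference is `∫ ⟪w, (v·∇)b⟫ = -∫ ⟪(v·∇)w, b⟫`
  have hdiff : (∫ x, ⟪w x, convect v (fourierTruncate N a) x⟫_ℝ) - ∫ x, ⟪w x, convect v a x⟫_ℝ =
      -∫ x, ⟪convect v w x, b x⟫_ℝ := by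
    rw [integral_inner_convect_eq_neg hv hvd hw hbs, neg_neg,
      ← integral_sub ((hw.inner (hv.convect hPa)).integrable) ((hw.inner (hv.convect ha)).integrable)]
    refine integral_congr_ae (ae_of_all _ fun x => ?_)
    dsimp only
    rw [hb, convect_sub v (hPa.isContDiff (by simp)) (ha.isContDiff (by simp)), inner_sub_right]
  rw [hdiff, abs_neg]
  refine (FluidPDE.abs_integral_inner_le_sqrt_mul_sqrt ((hv.convect hw).memLp 2)
    (hbs.memLp 2)).trans ?_
  have h1 : Real.sqrt (∫ x, ‖convect v w x‖ ^ 2) ≤ C * Real.sqrt (gradNormSq w) := by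
    rw [← Real.sqrt_sq hC, ← Real.sqrt_mul (sq_nonneg C)]
    exact Real.sqrt_le_sqrt (integral_norm_sq_convect_le_of_norm_le hw hvC)
  have h2 : Real.sqrt (∫ x, ‖b x‖ ^ 2) ≤
      Real.sqrt (gradNormSq a) / (2 * Real.pi * Real.sqrt ((N : ℝ) ^ 2 + 1)) :=
    sqrt_integral_norm_sq_fourierTruncate_sub_le ha N
  exact mul_le_mul h1 h2 (Real.sqrt_nonneg _) (by positivity)

/-- **Second convective term**: for smooth divergence-free `w`, smooth `v` with
`(∑ᵢ‖∂ᵢv‖²)^{1/2} ≤ D`, and smooth `a`,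
`|∫ ⟪v,(w·∇)P_N a⟫ - ∫ ⟪v,(w·∇)a⟫| ≤ D ‖w‖₂ · ‖∇a‖₂ / (2π (N²+1)^{1/2})`. [folklore] -/
theorem abs_integral_inner_convect_fourierTruncate_sub_le' {v w a : UnitAddTorus d → EuclideanSpace ℝ d}
    (hv : IsSmooth v) (hw : IsSmooth w) (hwd : IsDivFree w) (ha : IsSmooth a) {D : ℝ} (hD : 0 ≤ D)
    (hvD : ∀ x, Real.sqrt (∑ i, ‖partialDeriv i v x‖ ^ 2) ≤ D) (N : ℕ) :
    |(∫ x, ⟪v x, convect w (fourierTruncate N a) x⟫_ℝ) - ∫ x, ⟪v x, convect w a x⟫_ℝ| ≤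
      D * Real.sqrt (∫ x, ‖w x‖ ^ 2) *
        (Real.sqrt (gradNormSq a) / (2 * Real.pi * Real.sqrt ((N : ℝ) ^ 2 + 1))) := by
  set b : UnitAddTorus d → EuclideanSpace ℝ d := fourierTruncate N a - a with hb
  have hPa : IsSmooth (fourierTruncate N a) := isSmooth_fourierTruncate N a
  have hbs : IsSmooth b := hPa.sub ha
  have hdiff : (∫ x, ⟪v x, convect w (fourierTruncate N a) x⟫_ℝ) - ∫ x, ⟪v x, convect w a x⟫_ℝ =
      -∫ x, ⟪convect w v x, b x⟫_ℝ := by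
    rw [integral_inner_convect_eq_neg hw hwd hv hbs, neg_neg,
      ← integral_sub ((hv.inner (hw.convect hPa)).integrable) ((hv.inner (hw.convect ha)).integrable)]
    refine integral_congr_ae (ae_of_all _ fun x => ?_)
    dsimp only
    rw [hb, convect_sub w (hPa.isContDiff (by simp)) (ha.isContDiff (by simp)), inner_sub_right]
  rw [hdiff, abs_neg]
  refine (FluidPDE.abs_integral_inner_le_sqrt_mul_sqrt ((hw.convect hv).memLp 2)
    (hbs.memLp 2)).trans ?_
  have h1 : Real.sqrt (∫ x, ‖convect w v x‖ ^ 2) ≤ D * Real.sqrt (∫ x, ‖w x‖ ^ 2) := by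
    rw [← Real.sqrt_sq hD, ← Real.sqrt_mul (sq_nonneg D)]
    exact Real.sqrt_le_sqrt
      (integral_norm_sq_convect_le_of_sqrt_le (hv.isContDiff (by simp)) hw.continuous hvD)
  have h2 : Real.sqrt (∫ x, ‖b x‖ ^ 2) ≤
      Real.sqrt (gradNormSq a) / (2 * Real.pi * Real.sqrt ((N : ℝ) ^ 2 + 1)) :=
    sqrt_integral_norm_sq_fourierTruncate_sub_le ha N
  exact mul_le_mul h1 h2 (Real.sqrt_nonneg _) (by positivity)

/-! ## The convective terms under a uniformly small change of the base field -/

/-- Integration step shared by the two base-field estimates: a pointwise bound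
`|F x| ≤ T ‖w x‖ (∑ᵢ‖∂ᵢa(x)‖²)^{1/2}` integrates, by Cauchy–Schwarz, to `|∫ F| ≤ T ‖w‖₂ ‖∇a‖₂`
(continuous `w`, smooth `a`, `T ≥ 0`). [folklore] -/
theorem abs_integral_le_of_abs_le_mul_norm_mul_sqrt {F : UnitAddTorus d → ℝ}
    {w a : UnitAddTorus d → EuclideanSpace ℝ d} (hw : Continuous w) (ha : IsSmooth a) {T : ℝ}
    (hT : 0 ≤ T) (hpt : ∀ x, |F x| ≤ T * (‖w x‖ * Real.sqrt (∑ i, ‖partialDeriv i a x‖ ^ 2))) :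
    |∫ x, F x| ≤ T * (Real.sqrt (∫ x, ‖w x‖ ^ 2) * Real.sqrt (gradNormSq a)) := by
  have hc := continuous_sqrt_sum_norm_partialDeriv_sq ha
  have hCS := integral_norm_mul_norm_le_sqrt_sq_mul_sqrt_sq
    (hw.memLp_of_hasCompactSupport (HasCompactSupport.of_compactSpace w) (p := 2))
    (hc.memLp_of_hasCompactSupport (HasCompactSupport.of_compactSpace _) (p := 2))
  have hsq : ∀ x, ‖Real.sqrt (∑ i, ‖partialDeriv i a x‖ ^ 2)‖ = Real.sqrt (∑ i, ‖partialDeriv i a x‖ ^ 2) :=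
    fun x => by rw [Real.norm_eq_abs, abs_of_nonneg (Real.sqrt_nonneg _)]
  have hsq' : ∫ x, Real.sqrt (∑ i, ‖partialDeriv i a x‖ ^ 2) ^ 2 = gradNormSq a :=
    integral_congr_ae (ae_of_all _ fun x => Real.sq_sqrt (Finset.sum_nonneg fun i _ => sq_nonneg _))
  simp only [hsq, hsq'] at hCS
  calc |∫ x, F x| ≤ ∫ x, |F x| := abs_integral_le_integral_abs
    _ ≤ ∫ x, T * (‖w x‖ * Real.sqrt (∑ i, ‖partialDeriv i a x‖ ^ 2)) :=
        integral_mono_of_nonneg (ae_of_all _ fun x => abs_nonneg _)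
          (((hw.norm.mul hc).integrable_unitAddTorus).const_mul T) (ae_of_all _ hpt)
    _ = T * ∫ x, ‖w x‖ * Real.sqrt (∑ i, ‖partialDeriv i a x‖ ^ 2) := integral_const_mul _ _
    _ ≤ T * (Real.sqrt (∫ x, ‖w x‖ ^ 2) * Real.sqrt (gradNormSq a)) := mul_le_mul_of_nonneg_left hCS hT

/-- **First convective term, base field changed**: for smooth `v`, `v'`, `w`, `a` with
`‖v' x - v x‖ ≤ T`, `|∫ ⟪w,(v'·∇)a⟫ - ∫ ⟪w,(v·∇)a⟫| ≤ T ‖w‖₂ ‖∇a‖₂`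
(`(v'·∇)a - (v·∇)a = Da[v' - v]` and the Frobenius bound). [folklore] -/
theorem abs_integral_inner_convect_sub_le_of_norm_sub_le {v v' w a : UnitAddTorus d → EuclideanSpace ℝ d}
    (hv : IsSmooth v) (hv' : IsSmooth v') (hw : IsSmooth w) (ha : IsSmooth a) {T : ℝ} (hT : 0 ≤ T)
    (hvT : ∀ x, ‖v' x - v x‖ ≤ T) :
    |(∫ x, ⟪w x, convect v' a x⟫_ℝ) - ∫ x, ⟪w x, convect v a x⟫_ℝ| ≤
      T * (Real.sqrt (∫ x, ‖w x‖ ^ 2) * Real.sqrt (gradNormSq a)) := by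
  have ha1 : IsContDiff 1 a := ha.isContDiff (by simp)
  rw [← integral_sub ((hw.inner (hv'.convect ha)).integrable) ((hw.inner (hv.convect ha)).integrable)]
  refine abs_integral_le_of_abs_le_mul_norm_mul_sqrt hw.continuous ha hT fun x => ?_
  rw [← inner_sub_right, convect, convect, ← map_sub]
  refine (abs_real_inner_le_norm _ _).trans ?_
  calc ‖w x‖ * ‖Torus.fderiv a x (v' x - v x)‖
      ≤ ‖w x‖ * (‖v' x - v x‖ * Real.sqrt (∑ i, ‖partialDeriv i a x‖ ^ 2)) :=
        mul_le_mul_of_nonneg_left (norm_fderiv_apply_le_mul_sqrt ha1 x _) (norm_nonneg _)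
    _ ≤ ‖w x‖ * (T * Real.sqrt (∑ i, ‖partialDeriv i a x‖ ^ 2)) := by gcongr; exact hvT x
    _ = T * (‖w x‖ * Real.sqrt (∑ i, ‖partialDeriv i a x‖ ^ 2)) := by ring

/-- **Second convective term, base field changed**: for smooth `v`, `v'`, `w`, `a` with
`‖v' x - v x‖ ≤ T`, `|∫ ⟪v',(w·∇)a⟫ - ∫ ⟪v,(w·∇)a⟫| ≤ T ‖w‖₂ ‖∇a‖₂`. [folklore] -/
theorem abs_integral_inner_convect_sub_le_of_norm_sub_le' {v v' w a : UnitAddTorus d → EuclideanSpace ℝ d}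
    (hv : IsSmooth v) (hv' : IsSmooth v') (hw : IsSmooth w) (ha : IsSmooth a) {T : ℝ} (hT : 0 ≤ T)
    (hvT : ∀ x, ‖v' x - v x‖ ≤ T) :
    |(∫ x, ⟪v' x, convect w a x⟫_ℝ) - ∫ x, ⟪v x, convect w a x⟫_ℝ| ≤
      T * (Real.sqrt (∫ x, ‖w x‖ ^ 2) * Real.sqrt (gradNormSq a)) := by
  have ha1 : IsContDiff 1 a := ha.isContDiff (by simp)
  rw [← integral_sub ((hv'.inner (hw.convect ha)).integrable) ((hv.inner (hw.convect ha)).integrable)]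
  refine abs_integral_le_of_abs_le_mul_norm_mul_sqrt hw.continuous ha hT fun x => ?_
  rw [← inner_sub_left]
  exact (abs_real_inner_le_norm _ _).trans
    (mul_le_mul (hvT x) (norm_convect_le_norm_mul_sqrt ha1 w x) (norm_nonneg _) hT)

/-! ## The degenerate case `‖∇a‖₂ = 0` -/

/-- A smooth field with `‖∇a‖₂² = 0` has identically vanishing partial derivatives (the integrand
`∑ᵢ ‖∂ᵢa‖²` is continuous and nonnegative with integral zero). [folklore] -/
theorem partialDeriv_eq_zero_of_gradNormSq_eq_zero {a : UnitAddTorus d → EuclideanSpace ℝ d}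
    (ha : IsSmooth a) (h0 : gradNormSq a = 0) (i : d) (x : UnitAddTorus d) : partialDeriv i a x = 0 := by
  have hc : Continuous fun x => ∑ i, ‖partialDeriv i a x‖ ^ 2 :=
    continuous_finsetSum _ fun i _ => (ha.partialDeriv i).continuous.norm.pow 2
  have hnn : ∀ x, 0 ≤ ∑ i, ‖partialDeriv i a x‖ ^ 2 := fun x => Finset.sum_nonneg fun i _ => sq_nonneg _
  have hae : (fun x => ∑ i, ‖partialDeriv i a x‖ ^ 2) =ᵐ[volume] 0 :=
    (integral_eq_zero_iff_of_nonneg (fun x => hnn x) hc.integrable_unitAddTorus).1 h0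
  have hfun : (fun x => ∑ i, ‖partialDeriv i a x‖ ^ 2) = 0 :=
    (Continuous.ae_eq_iff_eq volume hc continuous_const).1 hae
  have hx : ∑ i, ‖partialDeriv i a x‖ ^ 2 = 0 := congrFun hfun x
  have hi := (Finset.sum_eq_zero_iff_of_nonneg fun i _ => sq_nonneg (‖partialDeriv i a x‖)).1 hx i
    (Finset.mem_univ i)
  exact norm_eq_zero.1 (pow_eq_zero_iff two_ne_zero |>.1 hi)

/-- If `‖∇a‖₂² = 0` for a smooth `a` then `(u·∇)a = 0`. [folklore] -/
theorem convect_eq_zero_of_gradNormSq_eq_zero {a : UnitAddTorus d → EuclideanSpace ℝ d}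
    (ha : IsSmooth a) (h0 : gradNormSq a = 0) (u : UnitAddTorus d → EuclideanSpace ℝ d)
    (x : UnitAddTorus d) : convect u a x = 0 := by
  rw [convect, fderiv_apply_eq_sum_partialDeriv (ha.isContDiff (by simp))]
  exact Finset.sum_eq_zero fun i _ => by rw [partialDeriv_eq_zero_of_gradNormSq_eq_zero ha h0, smul_zero]

/-- If `‖∇a‖₂² = 0` for a smooth `a` then `Δa = 0`. [folklore] -/
theorem laplacian_eq_zero_of_gradNormSq_eq_zero {a : UnitAddTorus d → EuclideanSpace ℝ d}
    (ha : IsSmooth a) (h0 : gradNormSq a = 0) (x : UnitAddTorus d) : laplacian a x = 0 := by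
  rw [laplacian_eq_sum_partialDeriv_partialDeriv ha]
  refine Finset.sum_eq_zero fun i _ => ?_
  have hfun : partialDeriv i a = fun _ => (0 : EuclideanSpace ℝ d) :=
    funext (partialDeriv_eq_zero_of_gradNormSq_eq_zero ha h0 i)
  rw [hfun]
  simp [partialDeriv, Torus.lineDeriv]

end Torus

end Literature.Analysis.FunctionSpaces
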